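import Mathlib
import Summits.Ventures.PercRepro2.SwOutMultiRootCube
import Summits.Ventures.PercRepro2.SwOutCoreCube
import Summits.Ventures.PercRepro2.SwOutArmGTyped

/-!
# The multi-root core cube: the edge sets, the flip and the inequality (blind cell PercRepro2,
night-4 g34, 2026-08-29; proofs/NIGHT4-G34.md §6)

From the cluster monotonicities of SwOutMultiRootCube: the red edge set of `h` is increasing in
the cube point and the blue one decreasing (`redEdges_coreReal_mono`, `blueEdges_coreReal_anti`),
the flip of the cube exchanges the red and the blue clusters and edge sets of a root
(`cluster_blue_coreReal_flipAll`, `blueEdges_coreReal_flipAll`), the cube stays in the class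
(`coreReal_mem_outClass`), the general doubly typed side pulls back to a lower set
(`coreReal_mem_gTypedQ_of_le`), the realisation is injective, and the rigid counting inequality
holds on `gTypedQ` over the cube: **`MultiBase.card_coreCube_le_g`** (g10's `card_le_of_cube_edges`).
-/

namespace Summit.Ventures.PercRepro2

namespace LocRows

open Hull

variable {V : Type*} {E : Type*}

open scoped Classical

variable {ends : E → Sym2 V}

section Ineq

variable {ι : Type*} {A : ι → Set V} {ζ : Config E} {R H : Set V} {h : V}
  (hb : MultiBase ends ζ R H A)
include hb

/-- **The red edge set of `h` is increasing in the cube point.** -/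
theorem MultiBase.redEdges_coreReal_mono (hh : h ∈ R) {ω ω' : Config ι} (hω : ω ≤ ω') :
    redEdges ends (coreReal ends A ζ ω) h ⊆ redEdges ends (coreReal ends A ζ ω') h := by
  rintro e ⟨he, hw⟩
  refine ⟨?_, within_mono (hb.cluster_coreReal_mono hh hω) hw⟩
  rw [← hb.coreReal_eq_of_within_true hω (hb.within_cluster_subset hh ω hw)]
  exact he

/-- **The blue edge set of `h` is decreasing in the cube point.** -/
theorem MultiBase.blueEdges_coreReal_anti (hh : h ∈ R) {ω ω' : Config ι} (hω : ω ≤ ω') :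
    blueEdges ends (coreReal ends A ζ ω') h ⊆ blueEdges ends (coreReal ends A ζ ω) h := by
  rintro e ⟨he, hw⟩
  refine ⟨?_, within_mono (hb.cluster_blue_coreReal_anti hh hω) hw⟩
  rw [blue_apply] at he ⊢
  rw [← hb.coreReal_eq_of_within_false hω (hb.within_cluster_blue_subset hh ω' hw)]
  exact he

/-! ### The flip of the cube -/

/-- The flipped cube point negates every edge touching an arm. -/
lemma MultiBase.coreReal_flipAll_apply_of_touches {ω : Config ι} {e : E}
    (he : e ∈ touches ends (allArms A)) :
    coreReal ends A ζ (flipAll ω) e = !coreReal ends A ζ ω e := by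
  obtain ⟨i, x, y, hxy, hx⟩ := MultiBase.exists_arm_of_touches_allArms' he
  rw [hb.coreReal_apply_of_mem hxy hx, hb.coreReal_apply_of_mem hxy hx]
  by_cases hi : ω i = true
  · have : flipAll ω i ≠ true := by simp [flipAll, hi]
    rw [if_neg this, if_pos hi]
  · have : flipAll ω i = true := by simp [flipAll]; simpa using hi
    rw [if_pos this, if_neg hi, Bool.not_not]

/-- An edge inside `H` touches an arm (no edge joins two roots). -/
lemma MultiBase.touches_allArms_of_within {e : E} (he : e ∈ within ends H) :
    e ∈ touches ends (allArms A) := by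
  obtain ⟨x, hx, y, hy, hxy⟩ := he
  by_cases hxR : x ∈ R
  · by_cases hyR : y ∈ R
    · exact absurd hxy (hb.no_root_root hxR hyR e)
    · obtain ⟨i, hi⟩ := hb.arm_cover y hy hyR
      exact ⟨y, ⟨i, hi⟩, x, ends_swap hxy⟩
  · obtain ⟨i, hi⟩ := hb.arm_cover x hx hxR
    exact ⟨x, ⟨i, hi⟩, y, hxy⟩

/-- **The flip of the cube exchanges the red and the blue clusters of a root.** -/
theorem MultiBase.cluster_blue_coreReal_flipAll {r : V} (hr : r ∈ R) (ω : Config ι) :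
    cluster ends (blue (coreReal ends A ζ (flipAll ω))) r = cluster ends (coreReal ends A ζ ω) r := by
  have hsub : within ends (R ∪ armsTrueC A ω) ⊆ within ends H := by
    rintro e ⟨x, hx, y, hy, hxy⟩
    have key : ∀ z, z ∈ R ∪ armsTrueC A ω → z ∈ H := by
      rintro z (hz | ⟨i, _, hz⟩)
      · exact hb.root_sub hz
      · exact (hb.arm_sub i z hz).1
    exact ⟨x, key x hx, y, key y hy, hxy⟩
  have hag : ∀ e ∈ within ends (R ∪ armsTrueC A ω),
      blue (coreReal ends A ζ (flipAll ω)) e = coreReal ends A ζ ω e := by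
    intro e he
    rw [blue_apply, hb.coreReal_flipAll_apply_of_touches (hb.touches_allArms_of_within (hsub he)),
      Bool.not_not]
  apply Set.Subset.antisymm
  · refine cluster_subset_of_agree_within (S := R ∪ armsTrueC A ω) ?_ (Or.inl hr) hag
    intro x hx y hxy
    have := hb.blue_closed (flipAll ω) (x := x) (y := y) (by rwa [armsFalseC_flipAll]) hxy
    rwa [armsFalseC_flipAll] at this
  · exact cluster_subset_of_agree_within (S := R ∪ armsTrueC A ω)
      (fun _ hx _ hxy => hb.red_closed ω hx hxy) (Or.inl hr) (fun e he => (hag e he).symm)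

/-- **The flip of the cube exchanges the red and the blue edge sets of `h`.** -/
theorem MultiBase.blueEdges_coreReal_flipAll (hh : h ∈ R) (ω : Config ι) :
    blueEdges ends (coreReal ends A ζ (flipAll ω)) h = redEdges ends (coreReal ends A ζ ω) h := by
  ext e
  simp only [blueEdges, mem_redEdges, hb.cluster_blue_coreReal_flipAll hh ω]
  constructor
  · rintro ⟨he, hw⟩
    refine ⟨?_, hw⟩
    have ht := hb.touches_allArms_of_within (within_mono (fun x hx => hb.hull_subset ω hh (Or.inl hx)) hw)
    rw [blue_apply, hb.coreReal_flipAll_apply_of_touches ht, Bool.not_not] at he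
    exact he
  · rintro ⟨he, hw⟩
    refine ⟨?_, hw⟩
    have ht := hb.touches_allArms_of_within (within_mono (fun x hx => hb.hull_subset ω hh (Or.inl hx)) hw)
    rw [blue_apply, hb.coreReal_flipAll_apply_of_touches ht, Bool.not_not]
    exact he

/-! ### The class, the side, the injectivity and the inequality -/

/-- **The cube stays in the class** (`H ⊆ U`, the base in the class). -/
theorem MultiBase.coreReal_mem_outClass [Fintype E] [DecidableEq E] {U : Set V} {ξ : Config E}
    (hh : h ∈ R) (hHU : H ⊆ U)
    (hcl : ζ ∈ outClass ends U h ξ) (ω : Config ι) :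
    coreReal ends A ζ ω ∈ outClass ends U h ξ := by
  rw [mem_outClass] at hcl ⊢
  refine ⟨fun e he => ?_, (hb.hull_subset ω hh).trans hHU⟩
  rw [← hcl.1 e he]
  apply MultiBase.coreReal_apply_of_notMem
  intro ht
  apply he
  obtain ⟨x, ⟨i, hx⟩, y, hxy⟩ := ht
  exact ⟨x, hHU (hb.arm_sub i x hx).1, y, hxy⟩

/-- **The general doubly typed side pulls back to a lower set of the cube** (`l` and `X` outside
`H`). -/
theorem MultiBase.coreReal_mem_gTypedQ_of_le [Fintype E] [DecidableEq E] {l : V}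
    {𝓤 𝓓 𝓓'' : Set (Set V)} {X : Set V} {𝓤' : Set (Set V)} (hh : h ∈ R) (h𝓤 : IsUpperSet 𝓤) (h𝓓 : IsLowerSet 𝓓)
    (h𝓓'' : IsLowerSet 𝓓'') (h𝓤' : IsUpperSet 𝓤') (hl : l ∉ H) (hX : ∀ x ∈ X, x ∉ H)
    {ω ω' : Config ι} (hω : ω ≤ ω')
    (hQ : coreReal ends A ζ ω' ∈ gTypedQ ends l h 𝓤 𝓓 𝓓'' X 𝓤') :
    coreReal ends A ζ ω ∈ gTypedQ ends l h 𝓤 𝓓 𝓓'' X 𝓤' := by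
  rw [mem_gTypedQ] at hQ ⊢
  obtain ⟨-, hA, hB, hRh, -, hBh⟩ := hQ
  refine ⟨?_, h𝓤 (hb.cluster_out_coreReal_anti hl hω) hA,
    h𝓓 (hb.cluster_blue_out_coreReal_mono hl hω) hB, h𝓓'' (hb.cluster_coreReal_mono hh hω) hRh,
    ?_, h𝓤' (hb.cluster_blue_coreReal_anti hh hω) hBh⟩
  · rintro (hhl | hhl)
    · exact (hb.root_notMem_cluster_out ω hl hh).1 hhl
    · exact (hb.root_notMem_cluster_out ω hl hh).2 hhl
  · intro x hx hxH
    exact hX x hx (hb.hull_subset ω hh hxH)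

/-- **The realisation is injective.** -/
theorem MultiBase.coreReal_injective : Function.Injective (coreReal ends A ζ) := by
  intro ω ω' heq
  funext i
  obtain ⟨x, hx⟩ := hb.arm_nonempty i
  obtain ⟨r, hr, hxr⟩ := hb.conn i x hx
  have hxe : ∃ e, x ∈ ends e :=
    exists_edge_of_mem_cluster (h := r) hxr (fun h' => (hb.arm_sub i x hx).2 (h' ▸ hr))
  obtain ⟨e, hxe⟩ := hxe
  have hxy : ends e = s(x, Sym2.Mem.other hxe) := (Sym2.other_spec hxe).symm
  have h1 := hb.coreReal_apply_of_mem (ω := ω) hxy hx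
  have h2 := hb.coreReal_apply_of_mem (ω := ω') hxy hx
  rw [heq] at h1
  rw [h1] at h2
  by_contra hne
  have key : ∀ b b' : Bool, b ≠ b' →
      (if b = true then ζ e else !ζ e) ≠ (if b' = true then ζ e else !ζ e) := by
    intro b b' hbb'
    cases b <;> cases b' <;> simp at hbb' ⊢
  exact key _ _ hne h2

/-- **THE MULTI-ROOT CUBE INEQUALITY, GENERAL DOUBLY TYPED SIDE**: the rigid counting inequality on
`gTypedQ` over the cube of a multi-root base (`H ⊆ U`, `l ∉ U`, `X` outside `H`). -/
theorem MultiBase.card_coreCube_le_g [Fintype E] [DecidableEq E] [Fintype ι] {U : Set V} {l : V}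
    {𝓤 𝓓 𝓓'' : Set (Set V)} {X : Set V} {𝓤' : Set (Set V)} (hh : h ∈ R) (h𝓤 : IsUpperSet 𝓤)
    (h𝓓 : IsLowerSet 𝓓) (h𝓓'' : IsLowerSet 𝓓'') (h𝓤' : IsUpperSet 𝓤') (hHU : H ⊆ U) (hl : l ∉ U)
    (hX : ∀ x ∈ X, x ∉ H) {𝓔 : Set (Set E)} (h𝓔 : IsUpperSet 𝓔) :
    ((coreCube ends A ζ).filter fun ζ' =>
        ζ' ∈ gTypedQ ends l h 𝓤 𝓓 𝓓'' X 𝓤' ∧ redEdges ends ζ' h ∈ 𝓔).card ≤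
      ((coreCube ends A ζ).filter fun ζ' =>
        ζ' ∈ gTypedQ ends l h 𝓤 𝓓 𝓓'' X 𝓤' ∧ blueEdges ends ζ' h ∈ 𝓔).card := by
  have hlH : l ∉ H := fun h' => hl (hHU h')
  have key := card_le_of_cube_edges (ends := ends) (coreReal ends A ζ) hb.coreReal_injective
    (coreCube ends A ζ) (fun ζ' => mem_coreCube)
    (↑(gTypedQ ends l h 𝓤 𝓓 𝓓'' X 𝓤'))
    (fun ω' ω hω hQ => hb.coreReal_mem_gTypedQ_of_le hh h𝓤 h𝓓 h𝓓'' h𝓤' hlH hX hω hQ) h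
    (fun 𝓔' h𝓔' ω ω' hω hω𝓔 => h𝓔' (hb.redEdges_coreReal_mono hh hω) hω𝓔)
    (fun 𝓔' h𝓔' ω' ω hω hω𝓔 => h𝓔' (hb.blueEdges_coreReal_anti hh hω) hω𝓔)
    (fun ω => hb.blueEdges_coreReal_flipAll hh ω) h𝓔
  simpa only [Finset.mem_coe] using key

end Ineq

end LocRows

end Summit.Ventures.PercRepro2
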